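import Mathlib.Analysis.Calculus.Gradient.Basic
import Mathlib.Analysis.InnerProductSpace.PiL2
import Mathlib.LinearAlgebra.Matrix.Charpoly.Coeff
import Mathlib.Analysis.Complex.Basic
import Literature.Analysis.FluidPDE.VectorCalculus
import HarnessLib

/-!
# Backward self-similar profiles of the 2D Boussinesq equations found by physics-informed neural
# networks (Wang–Lai–Gómez-Serrano–Buckmaster 2023), the empirical law of the unstable hierarchy and
# the "order of instability" (Wang et al. 2025)

Topic `Literature/Analysis/FluidPDE`. Definitions with bodies (the profile SYSTEM as a predicate, the
symmetry/normalisation constraints, the order of instability of a discretised linearisation), printed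
numerical values as data, and PROVED arithmetic. No named facts, no existence claims: both sources are
NUMERICAL (PINN + Gauss–Newton) — they produce CANDIDATE profiles, not theorems (cell vocabulary:
PROFILE-SPEC v0 §7, "PINN profile — as a CANDIDATE-producing method, no theorem").

Sources (held):
* Y. Wang, C.-Y. Lai, J. Gómez-Serrano, T. Buckmaster, *Asymptotic self-similar blow-up profile for
  three-dimensional axisymmetric Euler equations using neural networks*, Phys. Rev. Lett. 130 (2023)
  244002 = arXiv:2201.06780 [WangLaiGomezSerranoBuckmaster2023]: §1.1 eqs. (1.1)–(1.3) (p. 2 of the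
  held text), §2 (vorticity form, symmetries, constraints; p. 3), §2.2 ("self-similarity exponent of
  `λ ≈ 2` … in agreement with the exponent found by the PINN", p. 3).
* Y. Wang et al., *Discovery of Unstable Singularities*, arXiv:2509.14185 [WangEtAl2025]: main text
  p. 3–4 ("For the `n`-th unstable solution discovered, we find `n` unstable modes …"; "for the
  Boussinesq/Euler equations, we find that `λ_n ∼ 1/(1.4187n + 1.0863) + 1`"; IPM
  "`λ_n ∼ 1/(1.1459n + 0.9723)`"; CCF "`λ₁ ≈ 0.6057`, suggesting that singularities exist for any
  `α ≤ 1/(1+λ₁) ≈ 0.623`", "`λ₂ = 0.4703`"), Methods "Self-similar Solutions" (p. 11: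
  `φ_A(x,t) = (1−t)^{k_A(λ)}Φ_A(y)`, `y = (1−t)^{−(1+λ)}x`) and "Spectrum of Linearization" (p. 16).

## What is printed (WLGSB 2023, §1.1)

2D Boussinesq on the half plane `x₂ ≥ 0` with `u₂(x₁, 0) = 0` (1.1); backward self-similar ansatz
(1.2) `u = (1−t)^λ U(y)`, `θ = (1−t)^{−1+λ} Θ(y)`, `y = x/(1−t)^{1+λ}`; "Under the ansatz, the
equations (1.1) become (1.3):
`−λU + ((1+λ)y + U)·∇U + ∇P = (0, −Θ)`, `(1−λ)Θ + ((1+λ)y + U)·∇Θ = 0`, `div U = 0`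
for an implicitly defined `P`." §2: symmetries "`U₁` is odd and `(U₂, Θ)` are even in the `y₁`
direction", constraints "`U₂(y₁, 0) = 0` and `Θ(0, y₂) = 0`", normalisation "`∂_{y₁}Ω(0) = 1`"
(`Ω = ∂_{y₂}U₁ − ∂_{y₁}U₂`), and "`∇U, Φ, Ψ` all vanish at infinity" (`Φ = ∂₁Θ`, `Ψ = ∂₂Θ`).

In the convention of the tree's `selfSimilarCollapse` (`SelfSimilarCollapseAnsatz.lean`: velocity
`(T−t)^{γ−1} U(x/(T−t)^γ)`) the collapse exponent is `γ = 1 + λ` (`collapseExponent_wlgsb`).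

## Contents

* `IsSelfSimilarBoussinesqProfile lam U Θ P` — the profile system (1.3) on the open half plane
  `{y₂ > 0}` with continuity up to the wall and the non-penetration condition `U₂(y₁,0) = 0`
  (`ℝ² = EuclideanSpace ℝ (Fin 2)`, indices `0, 1` for `y₁, y₂`); `.zero` (trivial profile, API).
* `WLGSBConstraints lam U Θ` — the printed symmetry class, constraints and normalisation of §2.
* `wangEtAl2025_boussinesqLambda n = 1/(1.4187n + 1.0863) + 1`, `wangEtAl2025_ipmLambda n`,
  `wangEtAl2025_ccfLambda1 = 0.6057`, `wangEtAl2025_ccfLambda2 = 0.4703` (data); PROVED: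
  `one_lt_boussinesqLambda` (`λ_n > 1`, so `γ_n = 1 + λ_n > 2`), and the dissipation-threshold
  arithmetic `dissipationExponent α lam = 1 − α(1+λ)` — the power of `(1−t)` by which a dissipation
  `(−Δ)^{α/2}` is weaker than the inertial terms under the ansatz — with
  `dissipationExponent_pos_iff : 0 < 1 − α(1+λ) ↔ α < 1/(1+λ)` (the printed criterion
  "`α ≤ 1/(1+λ₁)`" up to the endpoint) and `dissipationExponent_two_neg_of_boussinesqLambda` (for the
  full Laplacian `α = 2` and every `λ_n` of the Boussinesq/Euler hierarchy the exponent is negative: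
  viscosity is NOT perturbative along that hierarchy — the cell's LIT-DOSSIER §8 remark, now a
  theorem about the printed numbers).
* `Matrix.rhpEigenvalueCount A` (eigenvalues of a real square matrix with `Re ≥ 0`, counted with
  algebraic multiplicity) and `Matrix.orderOfInstability A k = rhpEigenvalueCount A − k` (discount of
  `k` trivial symmetry eigenvalues): the printed "order of instability" for a finite-dimensional
  (discretised) linearisation `𝒟[Φ_λ]`, which is what the engineers' eigen-solvers compute;
  `rhpEigenvalueCount_le_card`.

## WHAT THIS IS NOT

Not a theorem that any Boussinesq/Euler self-similar profile exists, is smooth, or has `n` unstable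
directions: those are numerical findings (residuals `10⁻¹³…10⁻⁷`, no computer-assisted proof except
CCF "manuscript in preparation"). Nothing here is about Navier–Stokes; `γ_n = 1 + λ_n > 2 > ½`
places the whole printed hierarchy outside the regime where viscosity is perturbative
(`SelfSimilarCollapseAnsatz.lean`, `tendsto_effectiveViscosity_atTop_of_half_lt`).

## Mathlib / tree search

Tree: `IsSelfSimilarEulerProfile γ c U P` (`SelfSimilarEulerProfile.lean`, whole space, no
temperature), `selfSimilarCollapse` (physical ansatz), `VectorCalculus.divergence`; nothing for
Boussinesq profiles, PINN, or eigenvalue counts (`lean search 'Boussinesq|orderOfInstability|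
rhpEigenvalue|charpoly.roots'` in `Literature/Analysis`: none). Mathlib: `Matrix.charpoly`,
`Polynomial.roots`, `Matrix.charpoly_natDegree_eq_dim`, `Polynomial.card_roots'`.
-/

noncomputable section

open Set

namespace Literature.Analysis.FluidPDE

/-! ### The self-similar Boussinesq profile system (WLGSB 2023, (1.3)) -/

section Profile

/-- The open upper half plane `{y₂ > 0}` of the self-similar variable `y = (y₁, y₂)`
(WLGSB 2023 §1.1: the Boussinesq problem is posed on `x₂ ≥ 0`; `y = x/(1−t)^{1+λ}`). [cite: WangLaiGomezSerranoBuckmaster2023, §1.1 eq. (1.1)] -/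
def wlgsbHalfPlane : Set (EuclideanSpace ℝ (Fin 2)) := {y | 0 < y 1}

/-- The wall `{y₂ = 0}`. [cite: WangLaiGomezSerranoBuckmaster2023, §1.1 eq. (1.1)] -/
def wlgsbWall : Set (EuclideanSpace ℝ (Fin 2)) := {y | y 1 = 0}

/-- **The backward self-similar profile system of the 2D Boussinesq equations** (Wang–Lai–
Gómez-Serrano–Buckmaster 2023, (1.3)): under `u = (1−t)^λ U(y)`, `θ = (1−t)^{−1+λ}Θ(y)`,
`y = x/(1−t)^{1+λ}` (1.2), the Boussinesq equations (1.1) on `x₂ ≥ 0` with `u₂(x₁,0) = 0` become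
`−λU + ((1+λ)y + U)·∇U + ∇P = (0, −Θ)`, `(1−λ)Θ + ((1+λ)y + U)·∇Θ = 0`, `div U = 0`
"for an implicitly defined `P`". Rendered on the open half plane `{y₂ > 0}` (`C¹` there), with
continuity of `U, Θ` up to the wall and the non-penetration condition `U₂ = 0` on the wall;
`((1+λ)y + U)·∇U = DU(y)[(1+λ)y + U(y)]`, `(0,−Θ) = −Θ(y) e₂`. The printed mild-growth condition
at infinity and the normalisations are NOT part of this predicate (see `WLGSBConstraints`). In the
tree's `selfSimilarCollapse` convention the collapse exponent is `γ = 1 + λ`. [cite: WangLaiGomezSerranoBuckmaster2023, §1.1 eqs. (1.2)–(1.3)] -/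
structure IsSelfSimilarBoussinesqProfile (lam : ℝ) (U : EuclideanSpace ℝ (Fin 2) → EuclideanSpace ℝ (Fin 2))
    (Θ P : EuclideanSpace ℝ (Fin 2) → ℝ) : Prop where
  /-- `U ∈ C¹` on the open half plane -/
  contDiffOn_velocity : ContDiffOn ℝ 1 U wlgsbHalfPlane
  /-- `Θ ∈ C¹` on the open half plane -/
  contDiffOn_temperature : ContDiffOn ℝ 1 Θ wlgsbHalfPlane
  /-- `P ∈ C¹` on the open half plane -/
  contDiffOn_pressure : ContDiffOn ℝ 1 P wlgsbHalfPlane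
  /-- `U` is continuous up to the wall -/
  continuousOn_velocity : ContinuousOn U (wlgsbHalfPlane ∪ wlgsbWall)
  /-- `Θ` is continuous up to the wall -/
  continuousOn_temperature : ContinuousOn Θ (wlgsbHalfPlane ∪ wlgsbWall)
  /-- non-penetration `U₂(y₁, 0) = 0` (§2, first constraint; from `u₂(x₁,0) = 0` in (1.1)) -/
  wall : ∀ y ∈ wlgsbWall, U y 1 = 0
  /-- momentum: `−λU + DU(y)[(1+λ)y + U(y)] + ∇P(y) = −Θ(y) e₂` -/
  momentum : ∀ y ∈ wlgsbHalfPlane,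
    -lam • U y + fderiv ℝ U y ((1 + lam) • y + U y) + gradient P y =
      -(Θ y) • EuclideanSpace.single 1 1
  /-- temperature: `(1−λ)Θ + DΘ(y)[(1+λ)y + U(y)] = 0` -/
  temperature : ∀ y ∈ wlgsbHalfPlane, (1 - lam) * Θ y + fderiv ℝ Θ y ((1 + lam) • y + U y) = 0
  /-- incompressibility `div U = 0` -/
  divFree : ∀ y ∈ wlgsbHalfPlane, VectorCalculus.divergence U y = 0

/-- The trivial profile solves (1.3) for every `λ` (non-vacuity/API only; the printed profile is
nontrivial, `∂_{y₁}Ω(0) = 1`). [cite: WangLaiGomezSerranoBuckmaster2023, §1.1 eq. (1.3)] -/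
theorem IsSelfSimilarBoussinesqProfile.zero (lam : ℝ) : IsSelfSimilarBoussinesqProfile lam 0 0 0 := by
  refine ⟨contDiffOn_const, contDiffOn_const, contDiffOn_const, continuousOn_const, continuousOn_const,
    fun _ _ => rfl, fun y _ => ?_, fun y _ => ?_, fun y _ => ?_⟩
  · simp [gradient]
  · simp
  · simp [VectorCalculus.divergence]

/-- In the tree's convention (`selfSimilarCollapse γ T U`: velocity `(T−t)^{γ−1}U(x/(T−t)^γ)`), the
WLGSB ansatz `u = (1−t)^λ U(x/(1−t)^{1+λ})` has **collapse exponent `γ = 1 + λ`** (and velocity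
exponent `γ − 1 = λ`). [cite: WangLaiGomezSerranoBuckmaster2023, §1.1 eq. (1.2)] -/
def collapseExponent_wlgsb (lam : ℝ) : ℝ := 1 + lam

/-- `γ − 1 = λ`. [cite: WangLaiGomezSerranoBuckmaster2023, §1.1 eq. (1.2)] -/
theorem collapseExponent_wlgsb_sub_one (lam : ℝ) : collapseExponent_wlgsb lam - 1 = lam := by
  rw [collapseExponent_wlgsb]; ring

/-- **The symmetry class, constraints and normalisation of WLGSB 2023, §2**: "`U₁` is odd and
`(U₂, Θ)` are even in the `y₁` direction", "`U₂(y₁, 0) = 0` and `Θ(0, y₂) = 0`", and "to remove a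
symmetry, we add the constraint `∂_{y₁}Ω(0) = 1`", `Ω = ∂_{y₂}U₁ − ∂_{y₁}U₂` (the reflection is
`(y₁,y₂) ↦ (−y₁,y₂)`; `e₀, e₁` the coordinate vectors). The decay "`∇U, Φ, Ψ` vanish at infinity"
is recorded as the limits of `DU`, `∂₁Θ`, `∂₂Θ` along the cocompact filter. [cite: WangLaiGomezSerranoBuckmaster2023, §2 (symmetries, constraints, normalisation)] -/
structure WLGSBConstraints (U : EuclideanSpace ℝ (Fin 2) → EuclideanSpace ℝ (Fin 2))
    (Θ : EuclideanSpace ℝ (Fin 2) → ℝ) : Prop where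
  /-- `U₁` odd in `y₁` -/
  odd_U₁ : ∀ a b : ℝ, U !₂[-a, b] 0 = -(U !₂[a, b] 0)
  /-- `U₂` even in `y₁` -/
  even_U₂ : ∀ a b : ℝ, U !₂[-a, b] 1 = U !₂[a, b] 1
  /-- `Θ` even in `y₁` -/
  even_Θ : ∀ a b : ℝ, Θ !₂[-a, b] = Θ !₂[a, b]
  /-- `U₂(y₁, 0) = 0` -/
  wall_U₂ : ∀ a : ℝ, U !₂[a, 0] 1 = 0
  /-- `Θ(0, y₂) = 0` -/
  axis_Θ : ∀ b : ℝ, Θ !₂[0, b] = 0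
  /-- normalisation `∂_{y₁}Ω(0) = 1`, `Ω = ∂₂U₁ − ∂₁U₂` -/
  normalisation : fderiv ℝ (fun y => fderiv ℝ U y (EuclideanSpace.single 1 1) 0 -
      fderiv ℝ U y (EuclideanSpace.single 0 1) 1) 0 (EuclideanSpace.single 0 1) = 1
  /-- `∇U → 0` at infinity -/
  decay_DU : Filter.Tendsto (fun y => fderiv ℝ U y) (Filter.cocompact _) (nhds 0)
  /-- `Φ = ∂₁Θ → 0` and `Ψ = ∂₂Θ → 0` at infinity -/
  decay_DΘ : Filter.Tendsto (fun y => fderiv ℝ Θ y) (Filter.cocompact _) (nhds 0)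

end Profile

/-! ### The printed exponents: the unstable hierarchy and the dissipation threshold (Wang et al. 2025) -/

section Hierarchy

/-- **Empirical law of the Boussinesq/Euler hierarchy** (Wang et al. 2025, main text p. 4):
"For the Boussinesq/Euler equations, we find that `λ_n ∼ 1/(1.4187n + 1.0863) + 1`, where `λ_n`
indicates the `λ` value for the `n`-th unstable singularity." An extrapolated fit (data), recorded
as the function `n ↦ 1/(1.4187n + 1.0863) + 1`. [cite: WangEtAl2025, main text (empirical rule λ_n ∼ 1/(1.4187n + 1.0863) + 1)] -/
def wangEtAl2025_boussinesqLambda (n : ℕ) : ℝ := 1 / (1.4187 * n + 1.0863) + 1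

/-- **Empirical law of the IPM hierarchy**: "`λ_n ∼ 1/(1.1459n + 0.9723)`" (Wang et al. 2025,
p. 4). Data. [cite: WangEtAl2025, main text (IPM: λ_n ∼ 1/(1.1459n + 0.9723))] -/
def wangEtAl2025_ipmLambda (n : ℕ) : ℝ := 1 / (1.1459 * n + 0.9723)

/-- **CCF first unstable exponent `λ₁ ≈ 0.6057`** ("recently confirmed using PINN-based methods by
Wang et al. with `λ₁ ≈ 0.6057`, suggesting that singularities exist for any `α ≤ 1/(1+λ₁) ≈ 0.623`",
Wang et al. 2025 p. 3). Data. [cite: WangEtAl2025, main text (CCF λ₁ ≈ 0.6057)] -/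
def wangEtAl2025_ccfLambda1 : ℝ := 0.6057

/-- **CCF second unstable exponent `λ₂ = 0.4703`** (Wang et al. 2025 p. 3). Data. [cite: WangEtAl2025, main text (CCF λ₂ = 0.4703)] -/
def wangEtAl2025_ccfLambda2 : ℝ := 0.4703

/-- Every exponent of the printed Boussinesq/Euler law exceeds `1`: `λ_n > 1` (so the collapse
exponent `γ_n = 1 + λ_n > 2`). [cite: WangEtAl2025, main text (empirical rule λ_n ∼ 1/(1.4187n + 1.0863) + 1)] -/
theorem one_lt_boussinesqLambda (n : ℕ) : 1 < wangEtAl2025_boussinesqLambda n := by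
  rw [wangEtAl2025_boussinesqLambda]
  have : (0 : ℝ) < 1.4187 * n + 1.0863 := by positivity
  have : 0 < 1 / (1.4187 * (n : ℝ) + 1.0863) := by positivity
  linarith

/-- **The dissipation exponent** of a fractional dissipation `(−Δ)^{α/2}` (order `α`) against the
ansatz `u = (1−t)^λ U(x/(1−t)^{1+λ})`: inertial terms scale like `(1−t)^{λ−1}`, the dissipative term
like `(1−t)^{λ−α(1+λ)}`, so their ratio is `(1−t)^{1−α(1+λ)}` — dissipation is asymptotically
perturbative iff this exponent is positive. This is the arithmetic behind "a smaller value of `λ`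
corresponds to … a more severe singularity … which allows it to overcome greater dissipative effects"
and "singularities exist for any `α ≤ 1/(1+λ₁)`" (Wang et al. 2025 p. 3). [cite: WangEtAl2025, main text (dissipation threshold α ≤ 1/(1+λ))] -/
def dissipationExponent (α lam : ℝ) : ℝ := 1 - α * (1 + lam)

/-- **The printed threshold**: for `1 + λ > 0`, the dissipation exponent is positive iff
`α < 1/(1+λ)`. [cite: WangEtAl2025, main text (dissipation threshold α ≤ 1/(1+λ))] -/
theorem dissipationExponent_pos_iff {α lam : ℝ} (h : 0 < 1 + lam) :
    0 < dissipationExponent α lam ↔ α < 1 / (1 + lam) := by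
  rw [dissipationExponent, lt_div_iff₀ h]
  constructor <;> intro h' <;> linarith

/-- The CCF threshold number: `1/(1 + λ₁) = 1/1.6057` (`≈ 0.623` as printed). [cite: WangEtAl2025, main text (CCF: α ≤ 1/(1+λ₁) ≈ 0.623)] -/
theorem ccf_threshold_bounds :
    (0.622 : ℝ) < 1 / (1 + wangEtAl2025_ccfLambda1) ∧ 1 / (1 + wangEtAl2025_ccfLambda1) < 0.623 := by
  rw [wangEtAl2025_ccfLambda1]; norm_num

/-- **Full Laplacian along the Boussinesq/Euler hierarchy is never perturbative**: with `α = 2` and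
`λ = λ_n > 1` the dissipation exponent `1 − 2(1+λ_n)` is `< −3 < 0`; equivalently the collapse
exponent `γ_n = 1 + λ_n > ½`, the regime where the effective viscosity `ν(T−t)^{1−2γ}` blows up
(`SelfSimilarCollapseAnsatz.lean`). The printed programme ("It is expected that higher-order
instability makes it more feasible to treat viscosity as a perturbative error") therefore needs
exponents outside the printed law's range — an arithmetic remark on the printed numbers, not a claim
of the source. [cite: WangEtAl2025, main text (empirical rule λ_n and the viscosity programme, p. 4)] -/
theorem dissipationExponent_two_neg_of_boussinesqLambda (n : ℕ) :
    dissipationExponent 2 (wangEtAl2025_boussinesqLambda n) < -3 := by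
  have := one_lt_boussinesqLambda n
  rw [dissipationExponent]; linarith

end Hierarchy

/-! ### The order of instability of a (discretised) linearisation -/

section Instability

variable {m : Type*} [Fintype m] [DecidableEq m]

/-- The number of eigenvalues with NON-NEGATIVE real part, counted with algebraic multiplicity, of a
real square matrix (roots in `ℂ` of the characteristic polynomial). For a finite-dimensional
(discretised) linearisation `𝒟[Φ_λ]` of a profile equation this is the count entering Wang et al.'s
definition: "A profile `Φ_λ` is considered linearly stable if the portion of its spectrum with a
non-negative real part, `Re(μ) ≥ 0`, consists solely of the trivial eigenvalues arising from the
symmetries of the problem" (Methods, Spectrum of Linearization). [cite: WangEtAl2025, Methods (Spectrum of Linearization)] -/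
def _root_.Matrix.rhpEigenvalueCount (A : Matrix m m ℝ) : ℕ :=
  Multiset.card (((A.map (algebraMap ℝ ℂ)).charpoly.roots).filter fun z => 0 ≤ z.re)

/-- **Order of instability** (Wang et al. 2025, Methods: "The number of these non-trivial eigenvalues
`μ_i` with a non-negative real part, `Re(μ_i) ≥ 0`, is referred to as the order of instability"), for
a discretised linearisation `A` with `k` trivial (symmetry) eigenvalues in the closed right
half-plane: `rhpEigenvalueCount A − k`. The printed finding "for the `n`-th unstable solution
discovered, we find `n` unstable modes" reads `orderOfInstability = n` (a numerical observation, not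
asserted here). [cite: WangEtAl2025, Methods (Spectrum of Linearization: order of instability)] -/
def _root_.Matrix.orderOfInstability (A : Matrix m m ℝ) (k : ℕ) : ℕ :=
  A.rhpEigenvalueCount - k

omit [DecidableEq m] in
/-- The count is at most the dimension. [cite: WangEtAl2025, Methods (Spectrum of Linearization)] -/
theorem _root_.Matrix.rhpEigenvalueCount_le_card [DecidableEq m] (A : Matrix m m ℝ) :
    A.rhpEigenvalueCount ≤ Fintype.card m := by
  rw [Matrix.rhpEigenvalueCount]
  calc Multiset.card (((A.map (algebraMap ℝ ℂ)).charpoly.roots).filter fun z => 0 ≤ z.re)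
      ≤ Multiset.card (A.map (algebraMap ℝ ℂ)).charpoly.roots := Multiset.card_le_card
          (Multiset.filter_le _ _)
    _ ≤ (A.map (algebraMap ℝ ℂ)).charpoly.natDegree := Polynomial.card_roots' _
    _ = Fintype.card m := Matrix.charpoly_natDegree_eq_dim _

/-- The order of instability is at most the dimension. [cite: WangEtAl2025, Methods (Spectrum of Linearization: order of instability)] -/
theorem _root_.Matrix.orderOfInstability_le_card (A : Matrix m m ℝ) (k : ℕ) :
    A.orderOfInstability k ≤ Fintype.card m :=
  (Nat.sub_le _ _).trans A.rhpEigenvalueCount_le_card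

end Instability

end Literature.Analysis.FluidPDE
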